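import Literature.AlgebraicGeometry.Resolution.EquivariantOrderReduction
import Literature.AlgebraicGeometry.Resolution.EquivariantEmbeddedResolution
import HarnessLib

/-!
# Equivariant projective resolution of a stable subvariety of a smooth projective `G`-variety, char. 0 — PROVED (Kollár 2007, Thm. 3.36 (1)(4) / §3.4.1)

Topic: `Literature/AlgebraicGeometry/Resolution`. Theorems only (no definition, no named fact).

J. Kollár, *Lectures on Resolution of Singularities* (2007), Thm. 3.36: «(1) `X_r` is smooth … (4) `𝓑𝓡` commutes
with smooth morphisms» and §3.4.1 (p. 121): «Functoriality of resolutions implies that any group action on `X` lifts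
to `X′`.» The tree's named fact `Kollar2007_resolutionLiftsAutomorphisms` (`FunctorialResolutionAutomorphisms.lean`)
renders this for ALL automorphisms of an abstract projective variety, which needs the independence of the
resolution from the embedding (3.37–3.39, not formalised). This file proves, WITHOUT any named fact, the EMBEDDED
equivariant form that consumers with a finite group actually use:

* `exists_equivariant_projective_resolution` — **let `k` be a field of characteristic zero, `X` an integral regular
  projective `k`-scheme with an action `ρ` of a group `G` over `k`, and `ι : Y ↪ X` a `G`-stable integral closed
  subscheme (an action `ρY` on `Y` with `ι` equivariant). Then `Y` has a resolution of singularities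
  `r : Ỹ → Y` (proper, birational, `Ỹ` regular) with `Ỹ` PROJECTIVE over `k` and an action of `G` on `Ỹ` for
  which `r` is equivariant.** Proof: if `Y = X` take `r = 𝟙`; otherwise the value `𝓑𝓜𝓞_1(X, 𝓘_Y, ∅)` of Kollár's
  order-reduction functor (Thm. 3.69, a theorem of the tree) is self-induced along every `ρ g` by 3.34.1
  (`Kollar2007.CommutesWithSmoothMorphisms.eq_comap_of_isIso`, `EquivariantOrderReduction.lean`), and the
  equivariant swallowing recursion (`CentreSeq.IsResolutionOf.exists_equivariant_resolution_isProjectiveOver`,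
  `EquivariantEmbeddedResolution.lean`) extracts the equivariant projective resolution;
* `exists_equivariant_projective_resolution_actionOver` — the same with the action on `Ỹ` packaged as the tree's
  `ActionOver (r ≫ ι ≫ p) G`.

Route note: brick «B1+B2» of the Kollár-free deck family (P-3′) for route `HodgeConjecture/Q8SymplecticPowers` (crux
K1Q, stmt-HodgeConjecture-24190): the hypothesis `H` of `Q8Family.exists_genericModel_of_surfaceLifting`
(`QuaternionicQuarticGenericModelOfLifting.lean`) now lacks only (B3) a `Q₈`-equivariant closed immersion of the
generic model into a regular integral projective `K`-scheme and (B4) Thm. 3.36 (2) «isomorphism over the regular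
locus» for this resolution. Nothing here bears on HC.

## References

* [Kollar2007] J. Kollár, Lectures on Resolution of Singularities (2007), Thm. 3.36 (p. 132), 3.34.1 (p. 131),
  §3.4.1 (p. 121), Thm. 3.69 (p. 150), proof of Cor. 3.22 (pp. 124–125).
* [Hironaka1964] H. Hironaka, Resolution of singularities of an algebraic variety over a field of characteristic
  zero, Ann. of Math. 79 (1964), Main Theorem I.
-/

noncomputable section

open CategoryTheory CategoryTheory.Limits AlgebraicGeometry TopologicalSpace

namespace Literature.AlgebraicGeometry.Resolution

universe u

open Literature.AlgebraicGeometry.RelativeSpec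

variable {G : Type*} [Group G]

/-- The kernel of a closed immersion equivariant for actions on source and target is stable under the action on
the target: `(ρ g)^* 𝓘_Y = 𝓘_Y`. [cite: Kollar2007, §3.4.1 (p. 121)] -/
theorem ker_comap_eq_of_equivariant {X Y : Scheme.{u}} (ι : Y ⟶ X) [IsClosedImmersion ι] (ρ : G →* Aut X)
    (ρY : G →* Aut Y) (hι : ∀ g : G, (ρY g).hom ≫ ι = ι ≫ (ρ g).hom) (g : G) :
    ι.ker.comap (ρ g).hom = ι.ker := by
  have hmap : ∀ h : G, ι.ker.map (ρ h).hom = ι.ker := fun h => by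
    rw [← Scheme.Hom.ker_comp, ← hι h, Scheme.Hom.ker_comp_of_isIso]
  rw [comap_hom_eq_map_inv]
  have : (ρ g).inv = (ρ g⁻¹).hom := by rw [map_inv]; rfl
  rw [this, hmap]

/-- The range of a closed immersion equivariant for actions on source and target is stable:
`(ρ g)⁻¹(ι(Y)) = ι(Y)`. [cite: Kollar2007, §3.4.1 (p. 121)] -/
theorem preimage_range_eq_of_equivariant {X Y : Scheme.{u}} (ι : Y ⟶ X) (ρ : G →* Aut X)
    (ρY : G →* Aut Y) (hι : ∀ g : G, (ρY g).hom ≫ ι = ι ≫ (ρ g).hom) (g : G) :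
    (ρ g).hom ⁻¹' Set.range ι = Set.range ι := by
  have hsub : ∀ h : G, (ρ h).hom ⁻¹' Set.range ι ⊆ Set.range ι := by
    rintro h x ⟨y, hy⟩
    -- `x = (ρ h⁻¹) ((ρ h) x) = (ρ h⁻¹) (ι y) = ι ((ρY h⁻¹) y)`
    refine ⟨(ρY h⁻¹).hom y, ?_⟩
    have e1 : ι ((ρY h⁻¹).hom y) = (ρ h⁻¹).hom (ι y) := by
      rw [← Scheme.Hom.comp_apply, hι, Scheme.Hom.comp_apply]
    have e2 : (ρ h⁻¹).hom ((ρ h).hom x) = x := by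
      rw [← Scheme.Hom.comp_apply]
      have : (ρ h).hom ≫ (ρ h⁻¹).hom = 𝟙 X := by
        rw [← Iso.trans_hom, ← Aut.Aut_mul_def, ← map_mul, inv_mul_cancel, map_one]; rfl
      rw [this]; rfl
    rw [e1, hy, e2]
  refine Set.Subset.antisymm (hsub g) fun x hx => ?_
  -- `x ∈ ι(Y)` ⇒ `(ρ g) x = (ρ g⁻¹)⁻¹ x ∈ ι(Y)`
  have hx' : (ρ g).hom x ∈ (ρ g⁻¹).hom ⁻¹' Set.range ι := by
    show (ρ g⁻¹).hom ((ρ g).hom x) ∈ Set.range ι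
    rw [← Scheme.Hom.comp_apply]
    have : (ρ g).hom ≫ (ρ g⁻¹).hom = 𝟙 X := by
      rw [← Iso.trans_hom, ← Aut.Aut_mul_def, ← map_mul, inv_mul_cancel, map_one]; rfl
    rw [this]
    exact hx
  exact hsub g⁻¹ hx'

/-- **Equivariant projective resolution of a `G`-stable subvariety of a regular projective `G`-variety in
characteristic zero — unconditional.** For `k` of characteristic zero, `X` integral, regular and projective over `k`
(structure morphism `p`) with an action `ρ` of `G` over `k`, and a `G`-stable integral closed subscheme `ι : Y ↪ X`
(action `ρY` on `Y`, `ι` equivariant): there are a resolution of singularities `r : Ỹ → Y` with `Ỹ` projective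
over `k` and an action `ρỸ` of `G` on `Ỹ` with `r` equivariant.
[cite: Kollar2007, Thm. 3.36 (1)(4) (p. 132) with §3.4.1 (p. 121) and Thm. 3.69 (p. 150)] [cite: Hironaka1964, Main Theorem I] -/
theorem exists_equivariant_projective_resolution {k : Type u} [Field k] [CharZero k] {X : Scheme.{u}}
    (p : X ⟶ Spec (.of k)) [IsIntegral X] (hXreg : Scheme.IsRegular X)
    (hX : Literature.AlgebraicGeometry.Motives.IsProjectiveOver (Over.mk p)) {Y : Scheme.{u}} [IsIntegral Y]
    (ι : Y ⟶ X) [IsClosedImmersion ι] (ρ : ActionOver p G) (ρY : G →* Aut Y)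
    (hι : ∀ g : G, (ρY g).hom ≫ ι = ι ≫ (ρ.aut g).hom) :
    ∃ (Yt : Scheme.{u}) (r : Yt ⟶ Y) (ρt : G →* Aut Yt), IsResolution r ∧
      Literature.AlgebraicGeometry.Motives.IsProjectiveOver (Over.mk (r ≫ ι ≫ p)) ∧
      ∀ g : G, (ρt g).hom ≫ r = r ≫ (ρY g).hom := by
  haveI : IsProper p := Literature.AlgebraicGeometry.Motives.IsProjectiveOver.isProper (X := Over.mk p) hX
  haveI : IsLocallyNoetherian X := LocallyOfFiniteType.isLocallyNoetherian p
  by_cases hne : Set.range ι = Set.univ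
  · -- `Y = X`: `ι` is an isomorphism, `Y` is regular, the identity resolves
    haveI : Surjective ι := ⟨fun x => by
      have hx : x ∈ Set.range ι := by rw [hne]; trivial
      exact hx⟩
    haveI : IsIso ι := isIso_of_isClosedImmersion_of_surjective _
    have hYreg : Scheme.IsRegular Y := Scheme.IsRegular.of_isOpenImmersion ι hXreg
    refine ⟨Y, 𝟙 Y, ρY, ⟨inferInstance, ⟨⊤, by simp, by simp, inferInstance⟩, hYreg⟩, ?_, fun g => by simp⟩
    obtain ⟨n, e, he⟩ := hX
    refine ⟨n, Over.homMk (ι ≫ e.left) ?_, ?_⟩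
    · change (ι ≫ e.left) ≫ (Literature.AlgebraicGeometry.Motives.projectiveSpace n k).hom = 𝟙 Y ≫ ι ≫ p
      rw [Category.assoc, Category.id_comp]
      congr 1
      exact Over.w e
    · change IsClosedImmersion (ι ≫ e.left)
      exact MorphismProperty.comp_mem @IsClosedImmersion ι e.left inferInstance he
  · -- `Y ≠ X`: run Kollár's order reduction on `(X, 𝓘_Y, ∅, 1)`, equivariantly
    obtain ⟨n, hn⟩ := exists_equidim_of_isIntegral p
    let T : Kollar2007.Triple k n :=
      { X := X, struct := p, isRegular := hXreg, equidim := hn, ideal := ι.ker,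
        stalkIdeal_ne_bot := stalkIdeal_ne_bot_of_ne_bot (ker_ne_bot_of_range_ne_univ ι hne),
        boundary := [], hasSNC := hasSNC_nil_of_isRegular hXreg, boundary_pairwise := List.Pairwise.nil }
    obtain ⟨B, hres, hsm, -, -⟩ :=
      (Kollar2007Thm3_103.orderReduction Kollar2007Thm3_103_holds Kollar2007Thm3_107_holds n).2 1 le_rfl
    have hT : Kollar2007.TripleClass.all n T := trivial
    -- `𝓑(T) = (ρ g)^* 𝓑(T)` (3.34.1 along the automorphism `ρ g` of the triple)
    have hρs : ∀ g : G, B T = (B T).comap (ρ.aut g).hom := fun g =>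
      hsm.eq_comap_of_isIso T hT (ρ.aut g).hom
        ⟨ρ.aut_comp g, (ker_comap_eq_of_equivariant ι ρ.aut ρY hι g).symm, by rfl⟩
    have hρY' : ∀ g : G, (ρ.aut g).hom ⁻¹' Set.range ι = Set.range ι :=
      preimage_range_eq_of_equivariant ι ρ.aut ρY hι
    have hsres : (B T).IsResolutionOf ⟨ι.ker, [], 1⟩ := (hres T).1
    obtain ⟨Yt, r, ρt, hr, hproj, hequiv⟩ :=
      hsres.exists_equivariant_resolution_isProjectiveOver p hX ι [] ρ.aut hρs hρY'
    refine ⟨Yt, r, ρt, hr, hproj, fun g => ?_⟩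
    rw [← cancel_mono ι]
    simp only [Category.assoc]
    rw [hequiv g, Category.assoc, ← hι g]

/-- The same with the lifted action packaged as the tree's action datum over `k`: **an `ActionOver (r ≫ ι ≫ p) G`
on the equivariant projective resolution `Ỹ`, `r` equivariant.**
[cite: Kollar2007, Thm. 3.36 (1)(4) (p. 132) with §3.4.1 (p. 121)] -/
theorem exists_equivariant_projective_resolution_actionOver {k : Type u} [Field k] [CharZero k]
    {X : Scheme.{u}} (p : X ⟶ Spec (.of k)) [IsIntegral X] (hXreg : Scheme.IsRegular X)
    (hX : Literature.AlgebraicGeometry.Motives.IsProjectiveOver (Over.mk p)) {Y : Scheme.{u}} [IsIntegral Y]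
    (ι : Y ⟶ X) [IsClosedImmersion ι] (ρ : ActionOver p G) (ρY : ActionOver (ι ≫ p) G)
    (hι : ∀ g : G, (ρY.aut g).hom ≫ ι = ι ≫ (ρ.aut g).hom) :
    ∃ (Yt : Scheme.{u}) (r : Yt ⟶ Y) (ρt : ActionOver (r ≫ ι ≫ p) G), IsResolution r ∧
      Literature.AlgebraicGeometry.Motives.IsProjectiveOver (Over.mk (r ≫ ι ≫ p)) ∧
      ∀ g : G, (ρt.aut g).hom ≫ r = r ≫ (ρY.aut g).hom := by
  obtain ⟨Yt, r, ρt, hr, hproj, hequiv⟩ :=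
    exists_equivariant_projective_resolution p hXreg hX ι ρ ρY.aut hι
  refine ⟨Yt, r, ⟨ρt, fun g => ?_⟩, hr, hproj, hequiv⟩
  rw [← Category.assoc, hequiv g, Category.assoc, ρY.aut_comp]

end Literature.AlgebraicGeometry.Resolution

end
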